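import Mathlib
import Summits.KontsevichZagierPeriods.KontsevichZagierPeriods.Theses.InverseLandau

/-!
# `TateLifting`, line `Sketch`, stub `stub_tateSubst` — Tate substitution

Crux stmt-KontsevichZagierPeriods-9129 (`Summit.KontsevichZagierPeriods.KontsevichZagierPeriods.Theses.InverseLandau.TateLifting`).
Substituting a polynomial arc `u = p(ϖ)` (`p ∈ ℚ[X]^k`) for the `k` parameters of a `ℚ`-polynomial
`R(z, u)` in `n + k` variables gives a `ℚ`-polynomial `R'(z, ϖ)` in `n + 1` variables with
`R'(z, ϖ) = R(z, p(ϖ))` for all real `z, ϖ` (`MvPolynomial.bind₁` along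
`Fin.append (X ∘ Fin.castSucc) (fun j => Polynomial.aeval (X (Fin.last n)) (p j))`).
-/

noncomputable section

namespace Summit.KontsevichZagierPeriods.InverseLandau

open Literature.NumberTheory.Transcendental

/-- **Tate substitution** (stub `stub_tateSubst` of line `Sketch` for crux `TateLifting`): for
polynomials `p j ∈ ℚ[X]` and `R ∈ ℚ[z₁..zₙ, u₁..u_k]` there is `R' ∈ ℚ[z₁..zₙ, ϖ]` with
`R'(z, ϖ) = R(z, p(ϖ))` identically on `ℝⁿ × ℝ`. [folklore] -/
theorem tateLifting_tateSubst :
    ∀ (n k : ℕ) (p : Fin k → Polynomial ℚ) (R : MvPolynomial (Fin (n + k)) ℚ),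
      ∃ R' : MvPolynomial (Fin (n + 1)) ℚ, ∀ (z : Fin n → ℝ) (ϖ : ℝ),
        MvPolynomial.aeval (Fin.snoc z ϖ : Fin (n + 1) → ℝ) R' =
          MvPolynomial.aeval (Fin.append z (fun j => Polynomial.aeval ϖ (p j))) R := by
  intro n k p R
  refine ⟨MvPolynomial.bind₁ (Fin.append (fun i => MvPolynomial.X (Fin.castSucc i))
    (fun j => Polynomial.aeval (MvPolynomial.X (Fin.last n)) (p j))) R, fun z ϖ => ?_⟩
  rw [MvPolynomial.aeval_bind₁]
  refine congrArg (fun F : Fin (n + k) → ℝ => MvPolynomial.aeval F R)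
    (funext (Fin.addCases (fun i => ?_) fun j => ?_))
  · rw [Fin.append_left, Fin.append_left, MvPolynomial.aeval_X, Fin.snoc_castSucc]
  · rw [Fin.append_right, Fin.append_right, ← Polynomial.aeval_algHom_apply,
      MvPolynomial.aeval_X, Fin.snoc_last]

end Summit.KontsevichZagierPeriods.InverseLandau

end
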